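import Summits.ResolutionOfSingularities.ResolutionOfSingularities.Theorems.WeightedInvariantIota3LemmaCPrimeDivisible
import Summits.ResolutionOfSingularities.ResolutionOfSingularities.Theorems.WeightedInvariantIota3LemmaCPrimeHasse
import Mathlib.Algebra.Polynomial.Expand
import HarnessLib

/-!
# LEMMA C′ in iterated-polynomial form, IV: the FROBENIUS STEP (`P ∈ κ[V][Y^p]`) and the full statement `core`
# (door `HypersurfaceCentreConstruction`, stmt-ResolutionOfSingularities-19897; proof of LEMMA C′, memo RESIDUE-PLAN.md §3b)

Helper for `stub_keyRungGrHomLE_three` (def-free, `--supports 19897`).  In `κ[X][V][Y]` (set-up of …Iota3LemmaCPrimeVanishing):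
`coeff_one_pow_char` (`(τ^p)_1 = 0` in characteristic `p`), `fe_contract` (if `P = Q(Y^p)` satisfies the functional equation with
`τ`, then `Q` satisfies it with `τ^p` — `(Y + τ)^p = Y^p + τ^p`, `expand` is injective), **`lam_eq_zero_of_frobenius`** (`r₂ ∤ r₁`,
`p = char κ` prime, all exponents `c` with `λ_c ≠ 0` divisible by `p`: by induction `Q = λ (B − ãV^{ρ̃})^{ν/p}` for the weights
`(p r₁, r₂)`; if `ã ≠ 0` then `τ^p = ã((V+T)^{ρ̃} − V^{ρ̃})` with `p ∤ ρ̃` (as `r₂ ∤ r₁`), and the `V^1`-coefficient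
`ã ρ̃ T^{ρ̃−1} ≠ 0` of the right side contradicts `(τ^p)_1 = 0`; so `ã = 0` and `P = λ_ν Y^ν`), and **`core`**: LEMMA C′ —
by strong induction on `ν`, the cases `r₂ ∣ r₁` (`core_of_dvd`), Frobenius (`lam_eq_zero_of_frobenius`) and Hasse
(`tau_eq_zero_of_not_frobenius` + `lam_eq_zero_of_tau_eq_zero`): a pure `P` with `λ_ν ≠ 0` fixed by `V ↦ V + εX^j`, `Y ↦ Y + τ`
is `λ_ν (Y − aV^{r₁/r₂})^ν` with `a ≠ 0` only if `r₂ ∣ r₁`.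
[OURS · L1 W4.3 · (o70-b)/(Δ12); AI work, weaker than expert review; nothing here is a statement of the manuscript under review.]
-/

noncomputable section

open Polynomial

set_option linter.dupNamespace false -- mandated namespace of this single-conjunct summit

namespace Summit.ResolutionOfSingularities.ResolutionOfSingularities.Cruxes.HypersurfaceCentreConstruction.LocalEngine

namespace Iota3

namespace LemmaCPrime

variable {κ : Type} [Field κ]

/-- In characteristic `p`, `τ^p` has no `V^1`-coefficient. [folklore] -/
theorem coeff_one_pow_char {R : Type} [CommRing R] (p : ℕ) [hp : Fact p.Prime] [CharP R p] (τ : R[X]) :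
    (τ ^ p).coeff 1 = 0 := by
  haveI : ExpChar R p := ExpChar.prime hp.out
  rw [← map_frobenius_expand, coeff_map, coeff_expand hp.out.pos, if_neg, map_zero]
  intro h
  exact hp.out.one_lt.ne' (Nat.dvd_one.mp h)

/-- **The functional equation descends along `Y ↦ Y^p`**: in characteristic `p`, if `Q(Y^p) = (Q(Y^p).map σ)(Y + τ)` then
`Q = (Q.map σ)(Y + τ^p)`. [folklore] -/
theorem fe_contract {R : Type} [CommRing R] (p : ℕ) [hp : Fact p.Prime] [CharP R p] (σ : R →+* R) (Q : R[X]) (τ : R)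
    (hfe : expand R p Q = taylor τ ((expand R p Q).map σ)) : Q = taylor (τ ^ p) (Q.map σ) := by
  apply expand_injective hp.out.pos
  conv_lhs => rw [hfe]
  rw [map_expand, taylor_apply, taylor_apply, expand_eq_comp_X_pow, expand_eq_comp_X_pow, comp_assoc, comp_assoc,
    X_pow_comp, add_comp, X_comp, C_comp, add_pow_char, ← map_pow]

/-- **THE FROBENIUS STEP.**  `r₂ ∤ r₁`, `p = char κ` prime, and every `λ_c ≠ 0` has `p ∣ c`: given LEMMA C′ for the contracted
polynomial `Q` (`P = Q(Y^p)`, weights `(p r₁, r₂)`, degree `ν/p`; supplied as the induction hypothesis `IH`), all `λ_c`, `c < ν`,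
vanish. [OURS · L1 W4.3 · (o70-b)/(Δ12)] -/
theorem lam_eq_zero_of_frobenius {r₁ r₂ ν : ℕ} (hr₂ : 0 < r₂) (hr : r₂ < r₁) (hν1 : 1 ≤ ν) (hndvd : ¬ r₂ ∣ r₁)
    {lam : ℕ → κ} {ex : ℕ → ℕ} {P : κ[X][X][X]} (hP : ∀ c, P.coeff c = monomial (ex c) (C (lam c)))
    (hex : ∀ c, lam c ≠ 0 → c ≤ ν ∧ r₂ * ex c = r₁ * (ν - c)) (hν : lam ν ≠ 0)
    {ε : κ} (hε : ε ≠ 0) {j : ℕ} {τ : κ[X][X]} (hfe : P = taylor τ (P.map (taylorAlgHom (C ε * X ^ j)).toRingHom))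
    (hp : (ringChar κ).Prime) (hB2 : ∀ c, lam c ≠ 0 → ringChar κ ∣ c)
    (IH : ∀ (lam' : ℕ → κ) (ex' : ℕ → ℕ) (P' : κ[X][X][X]) (τ' : κ[X][X]),
      (∀ c, P'.coeff c = monomial (ex' c) (C (lam' c))) →
      (∀ c, lam' c ≠ 0 → c ≤ ν / ringChar κ ∧ r₂ * ex' c = (ringChar κ * r₁) * (ν / ringChar κ - c)) →
      lam' (ν / ringChar κ) ≠ 0 → P' = taylor τ' (P'.map (taylorAlgHom (C ε * X ^ j)).toRingHom) →
      ∃ a : κ, P' = C (C (C (lam' (ν / ringChar κ)))) * (X - C (C (C a) * X ^ (ringChar κ * r₁ / r₂))) ^ (ν / ringChar κ) ∧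
        (a ≠ 0 → r₂ ∣ ringChar κ * r₁)) :
    ∀ c, c < ν → lam c = 0 := by
  classical
  set p := ringChar κ with hpdef
  haveI := Fact.mk hp
  haveI : CharP κ p := ringChar.charP κ
  have hpν : p ∣ ν := hB2 ν hν
  set ν' := ν / p with hν'def
  have hpν' : ν' * p = ν := Nat.div_mul_cancel hpν
  have hν'1 : 1 ≤ ν' := by
    rw [hν'def]; exact (Nat.one_le_div_iff hp.pos).mpr (Nat.le_of_dvd (by omega) hpν)
  set T : κ[X] := C ε * X ^ j with hT
  have hT0 : T ≠ 0 := T_ne_zero hε j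
  -- the contraction `Q`, `P = Q(Y^p)`
  set Q := contract p P with hQ
  have hQc : ∀ c, Q.coeff c = monomial (ex (c * p)) (C (lam (c * p))) := fun c => by
    rw [hQ, coeff_contract hp.ne_zero, hP]
  have hexQ : ∀ c, lam (c * p) ≠ 0 → c ≤ ν' ∧ r₂ * ex (c * p) = (p * r₁) * (ν' - c) := by
    intro c hl
    obtain ⟨h1, h2⟩ := hex (c * p) hl
    refine ⟨?_, ?_⟩
    · rw [hν'def]; exact (Nat.le_div_iff_mul_le hp.pos).mpr h1
    · rw [h2, ← hpν', ← Nat.sub_mul]; ring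
  have hνQ : lam (ν' * p) ≠ 0 := by rw [hpν']; exact hν
  have hPQ : expand κ[X][X] p Q = P := by
    refine Polynomial.ext fun n => ?_
    rw [coeff_expand hp.pos]
    split_ifs with hdn
    · rw [hQc, Nat.div_mul_cancel hdn, hP]
    · rw [hP n]
      have : lam n = 0 := by
        by_contra h; exact hdn (hB2 n h)
      rw [this, map_zero, map_zero]
  have hfeQ : Q = taylor (τ ^ p) (Q.map (taylorAlgHom T).toRingHom) :=
    fe_contract p _ Q τ (by rw [hPQ]; exact hfe)
  obtain ⟨a, hQeq, hadvd⟩ := IH (fun c => lam (c * p)) (fun c => ex (c * p)) Q (τ ^ p) hQc hexQ hνQ hfeQ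
  rcases eq_or_ne a 0 with ha | ha
  · -- `ã = 0`: `Q = λ B^{ν'}`, so `λ_c = 0` for all `c < ν`
    rw [ha, map_zero, map_zero, zero_mul, map_zero, show (X : κ[X][X][X]) - 0 = X from sub_zero (X : κ[X][X][X])] at hQeq
    intro c hc
    by_cases hpc : p ∣ c
    · obtain ⟨c', rfl⟩ := hpc
      have hc' : c' < ν' := by
        refine Nat.lt_of_mul_lt_mul_right (a := p) ?_
        rw [hpν', mul_comm]; exact hc
      have h := hQc c'
      rw [hQeq, coeff_C_mul_X_pow, if_neg hc'.ne, eq_comm, monomial_eq_zero_iff, C_eq_zero, mul_comm] at h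
      exact h
    · by_contra h; exact hpc (hB2 c h)
  · -- `ã ≠ 0`: then `r₂ ∣ p r₁`, `ρ̃ = p r₁ / r₂` with `p ∤ ρ̃`, and `τ^p = ã((V+T)^{ρ̃} − V^{ρ̃})` is impossible
    exfalso
    have hdvd' : r₂ ∣ p * r₁ := hadvd ha
    set ρ' := p * r₁ / r₂ with hρ'def
    have hρ' : r₂ * ρ' = p * r₁ := Nat.mul_div_cancel' hdvd'
    have hpρ' : ¬ p ∣ ρ' := by
      rintro ⟨m, hm⟩
      apply hndvd
      refine ⟨m, ?_⟩
      have h := hρ'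
      rw [hm, mul_left_comm] at h
      exact (Nat.eq_of_mul_eq_mul_left hp.pos h).symm
    have hρ'2 : 2 ≤ ρ' := by nlinarith [hp.two_le, hr, hρ', hr₂]
    set α : κ[X][X] := C (C a) * X ^ ρ' with hα
    have hL0 : (C (C (lam (ν' * p))) : κ[X][X]) ≠ 0 := by rw [Ne, C_eq_zero, C_eq_zero]; exact hνQ
    have hσ : ∀ f : κ[X][X], (taylorAlgHom T).toRingHom f = taylor T f := fun f => rfl
    -- evaluate the functional equation for `Q` at `Y = α`
    have E3 : τ ^ p = taylor T α - α := by
      have h := congr_arg (eval α) hfeQ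
      rw [taylor_eval] at h
      rw [hQeq, Polynomial.map_mul, Polynomial.map_pow, Polynomial.map_sub, map_C, map_X, map_C, hσ, hσ, taylor_C,
        eval_mul, eval_C, eval_pow, eval_sub, eval_X, eval_C, sub_self, zero_pow (by omega), mul_zero, eval_mul, eval_C,
        eval_pow, eval_sub, eval_X, eval_C] at h
      have h2 := pow_eq_zero_iff (by omega : ν' ≠ 0) |>.mp ((mul_eq_zero.mp h.symm).resolve_left hL0)
      linear_combination h2
    -- compare the `V^1`-coefficients
    have h1 := congr_arg (fun f : κ[X][X] => f.coeff 1) E3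
    rw [coeff_one_pow_char p τ, hα, taylor_mul, taylor_C, taylor_pow, taylor_X, coeff_sub, coeff_C_mul, coeff_C_mul,
      coeff_X_add_C_pow, coeff_X_pow, if_neg (by omega : (1 : ℕ) ≠ ρ'), mul_zero, sub_zero, Nat.choose_one_right] at h1
    have hρ'κ : (ρ' : κ[X]) ≠ 0 := by
      rw [← map_natCast C, Ne, C_eq_zero, CharP.cast_eq_zero_iff κ p]
      exact hpρ'
    exact (mul_ne_zero (by rw [Ne, C_eq_zero]; exact ha) (mul_ne_zero (pow_ne_zero _ hT0) hρ'κ)) h1.symm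

/-- **LEMMA C′ (iterated-polynomial form).**  Let `κ` be a field, `0 < r₂ < r₁`, `1 ≤ ν`, `ε ≠ 0`, `1 ≤ j`, and let
`P = Σ_c λ_c V^{e_c} Y^c ∈ κ[X][V][Y]` be PURE (`r₂ e_c = r₁ (ν − c)` and `c ≤ ν` whenever `λ_c ≠ 0`) with `λ_ν ≠ 0`, fixed by the
substitution `V ↦ V + εX^j`, `Y ↦ Y + τ` (`τ ∈ κ[X][V]`): `P = taylor τ (P.map (taylor (εX^j)))`.  Then
`P = λ_ν (Y − a V^{r₁/r₂})^ν` for some `a ∈ κ`, and `a ≠ 0` only if `r₂ ∣ r₁`.  (Strong induction on `ν`: `core_of_dvd`,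
`lam_eq_zero_of_frobenius`, `tau_eq_zero_of_not_frobenius`.) [OURS · L1 W4.3 · (o70-b)/(Δ12)] -/
theorem core {ε : κ} (hε : ε ≠ 0) {j : ℕ} (hj : 1 ≤ j) (ν : ℕ) :
    ∀ (r₁ r₂ : ℕ) (lam : ℕ → κ) (ex : ℕ → ℕ) (P : κ[X][X][X]) (τ : κ[X][X]),
      0 < r₂ → r₂ < r₁ → 1 ≤ ν → (∀ c, P.coeff c = monomial (ex c) (C (lam c))) →
      (∀ c, lam c ≠ 0 → c ≤ ν ∧ r₂ * ex c = r₁ * (ν - c)) → lam ν ≠ 0 →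
      P = taylor τ (P.map (taylorAlgHom (C ε * X ^ j)).toRingHom) →
      ∃ a : κ, P = C (C (C (lam ν))) * (X - C (C (C a) * X ^ (r₁ / r₂))) ^ ν ∧ (a ≠ 0 → r₂ ∣ r₁) := by
  induction ν using Nat.strong_induction_on with
  | _ ν IH =>
  intro r₁ r₂ lam ex P τ hr₂ hr hν1 hP hex hν hfe
  by_cases hdvd : r₂ ∣ r₁
  · obtain ⟨a, ha⟩ := core_of_dvd hr₂ hr hν1 hdvd hP hex hν hε hj hfe
    exact ⟨a, ha, fun _ => hdvd⟩
  · have hzero : ∀ c, c < ν → lam c = 0 := by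
      by_cases hB2 : (ringChar κ).Prime ∧ ∀ c, lam c ≠ 0 → ringChar κ ∣ c
      · have hp := hB2.1
        refine lam_eq_zero_of_frobenius hr₂ hr hν1 hdvd hP hex hν hε hfe hp hB2.2 ?_
        intro lam' ex' P' τ' hP' hex' hν' hfe'
        exact IH (ν / ringChar κ) (Nat.div_lt_self (by omega) hp.one_lt) (ringChar κ * r₁) r₂ lam' ex' P' τ' hr₂
          (lt_of_lt_of_le hr (Nat.le_mul_of_pos_left r₁ hp.pos))
          ((Nat.one_le_div_iff hp.pos).mpr (Nat.le_of_dvd (by omega) (hB2.2 ν hν))) hP' hex' hν' hfe'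
      · have hτ := tau_eq_zero_of_not_frobenius hr₂ hν1 hdvd hP hex hν hε hfe hB2
        rw [hτ] at hfe
        exact lam_eq_zero_of_tau_eq_zero hr hP hex hε hfe
    refine ⟨0, ?_, fun h => absurd rfl h⟩
    rw [map_zero, map_zero, zero_mul, map_zero, show (X : κ[X][X][X]) - 0 = X from sub_zero (X : κ[X][X][X])]
    exact eq_C_mul_X_pow_of_lam_eq_zero hr₂ hP hex hν hzero

end LemmaCPrime

end Iota3

end Summit.ResolutionOfSingularities.ResolutionOfSingularities.Cruxes.HypersurfaceCentreConstruction.LocalEngine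

end
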